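import Summits.QuantumAdvantage.QuantumAdvantage.Theorems.LinnikCubicClassGroupsDegreeOnePrimesEscapeFrobeniusWindowBookkeeping
import HarnessLib

/-!
# The Chebotarev density theorem in short intervals with Deuring–Heilbronn: real-variable numerics

Topic `Summits/QuantumAdvantage/QuantumAdvantage/Theorems`, cell B2b-1 (linnik-cubic), PART A (gen 17); helper
toward the crux `DegreeOnePrimesEscape` (stmt-QuantumAdvantage-11543) of route `LinnikCubicClassGroups`.
HONEST FRAMING: the value of this file is a THEOREM (kernel-checked lemmas of real analysis) — NOT summit progress.

Three inequalities used by `…FrobeniusWindowDH.lean` (Hoheisel's flat part at height `T₁ = X^θ` combined with the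
Deuring–Heilbronn zero repulsion):
* `flat_le_of_theta_le` — `2eD e^{−c/(6θ)} ≤ t` once `θ ≤ c/(6 log(2eD/t + 3))`;
* `dh_flat_le` — in the Deuring–Heilbronn regime (`μ₁ = (1 − β₁) log x`, `2Cnμ₁ ≤ 1/3`, `μ₁ ≥ c₁Q^{−2}`), with the
  repelled zero-free constant `c_Z = min(log(1/(2Cnμ₁))/(Cn), a log Q/2)`:  `2eD e^{−c_Z/(6θ)} ≤ t μ₁` once
  `6θCn(2 + log⁺(4eDCn/t)/log 3) ≤ 1` and `12θ(2 + log⁺(2eD/(tc₁))/log 12) ≤ a` — the gain `μ₁` is exactly what makes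
  the error RELATIVE to the flat main term `h(1 − x^{β₁−1}) ≍ h·min(1, μ₁)`;
* `dh_junk_le` — the secondary terms with a collar ratio `ε₀ ≥ e₀Q^{−2}` are `≤ (κc₁/2) Q^{−2}` after absorption.
-/

noncomputable section

open Real

namespace Summit.QuantumAdvantage.QuantumAdvantage.Theorems.DegreeOnePrimesEscape

/-- `2eD e^{−c/(6θ)} ≤ t` once `0 < θ ≤ c/(6 log(2eD/t + 3))`. -/
theorem flat_le_of_theta_le {D c θ t : ℝ} (hD : 0 < D) (hθ0 : 0 < θ) (ht : 0 < t)
    (hθ : θ ≤ c / (6 * Real.log (2 * Real.exp 1 * D / t + 3))) :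
    2 * Real.exp 1 * D * Real.exp (-(c / (6 * θ))) ≤ t := by
  set Λ : ℝ := Real.log (2 * Real.exp 1 * D / t + 3) with hΛ
  have hΛarg : 1 < 2 * Real.exp 1 * D / t + 3 := by
    have : 0 < 2 * Real.exp 1 * D / t := by positivity
    linarith
  have hΛ0 : 0 < Λ := Real.log_pos hΛarg
  have h1 : Λ ≤ c / (6 * θ) := by
    rw [le_div_iff₀ (by positivity)]
    have := (le_div_iff₀ (by positivity : (0 : ℝ) < 6 * Λ)).1 hθ
    linarith
  have h2 : Real.exp (-(c / (6 * θ))) ≤ Real.exp (-Λ) := Real.exp_le_exp.2 (by linarith)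
  have h3 : Real.exp (-Λ) = (2 * Real.exp 1 * D / t + 3)⁻¹ := by
    rw [hΛ, Real.exp_neg, Real.exp_log (by linarith)]
  have h4 : 2 * Real.exp 1 * D * (2 * Real.exp 1 * D / t + 3)⁻¹ ≤ t := by
    rw [← div_eq_mul_inv, div_le_iff₀ (by linarith)]
    have : t * (2 * Real.exp 1 * D / t + 3) = 2 * Real.exp 1 * D + 3 * t := by field_simp
    rw [this]; linarith
  calc 2 * Real.exp 1 * D * Real.exp (-(c / (6 * θ))) ≤ 2 * Real.exp 1 * D * Real.exp (-Λ) :=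
        mul_le_mul_of_nonneg_left h2 (by positivity)
    _ ≤ t := by rw [h3]; exact h4

/-- **The flat part in the Deuring–Heilbronn regime** (see the module docstring). -/
theorem dh_flat_le {C n D a θ t c₁ Q μ₁ : ℝ} (hC : 0 < C) (hn : 2 ≤ n) (hD : 0 < D) (ha : 1 ≤ a)
    (hθ0 : 0 < θ) (ht : 0 < t) (hc₁ : 0 < c₁) (hQ : 12 ≤ Q) (hμ0 : 0 < μ₁)
    (hμQ : c₁ * Q ^ (-(2 : ℝ)) ≤ μ₁) (hsmall : 2 * C * n * μ₁ ≤ 1 / 3)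
    (hθ1 : 6 * θ * C * n * (2 + max 0 (Real.log (4 * Real.exp 1 * D * C * n / t)) / Real.log 3) ≤ 1)
    (hθ2 : 12 * θ * (2 + max 0 (Real.log (2 * Real.exp 1 * D / (t * c₁))) / Real.log 12) ≤ a) :
    2 * Real.exp 1 * D * Real.exp (-(min (Real.log (1 / (2 * C * n * μ₁)) / (C * n)) (a * Real.log Q / 2) / (6 * θ))) ≤
      t * μ₁ := by
  have hn0 : 0 < n := by linarith
  have hCn : 0 < C * n := by positivity
  have hQ0 : 0 < Q := by linarith
  have hQ1 : 1 < Q := by linarith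
  have hlog3 : 0 < Real.log 3 := Real.log_pos (by norm_num)
  have hlog12 : 0 < Real.log 12 := Real.log_pos (by norm_num)
  have hlogQ : Real.log 12 ≤ Real.log Q := Real.log_le_log (by norm_num) hQ
  set u : ℝ := 2 * C * n * μ₁ with hu
  have hu0 : 0 < u := by positivity
  have hu3 : u ≤ 1 / 3 := hsmall
  rcases min_cases (Real.log (1 / (2 * C * n * μ₁)) / (C * n)) (a * Real.log Q / 2) with ⟨hmin, _⟩ | ⟨hmin, hle⟩
  · -- (B1) `c_Z = log(1/u)/(Cn)`: `exp(−c_Z/(6θ)) = u^p`, `p = 1/(6θCn) ≥ 2 + log⁺(4eDCn/t)/log 3`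
    rw [hmin]
    set p : ℝ := 1 / (6 * θ * C * n) with hp
    have hp0 : 0 < p := by positivity
    have hpge : 2 + max 0 (Real.log (4 * Real.exp 1 * D * C * n / t)) / Real.log 3 ≤ p := by
      rw [hp, le_div_iff₀ (by positivity)]; linarith
    have hexp : Real.exp (-(Real.log (1 / (2 * C * n * μ₁)) / (C * n) / (6 * θ))) = u ^ p := by
      rw [Real.rpow_def_of_pos hu0, hu, one_div, Real.log_inv, hp]
      congr 1
      field_simp
    rw [hexp]
    -- `u^p = u · u^{p−1} ≤ u · (1/3)^{p−1}` and `(1/3)^{p−1} ≤ t/(4eDCn)`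
    have hsplit : u ^ p = u * u ^ (p - 1) := by
      conv_lhs => rw [show p = 1 + (p - 1) by ring, Real.rpow_add hu0, Real.rpow_one]
    have hp1 : 1 ≤ p - 1 := by
      have : 0 ≤ max 0 (Real.log (4 * Real.exp 1 * D * C * n / t)) / Real.log 3 := by positivity
      linarith
    have hupow : u ^ (p - 1) ≤ (1 / 3 : ℝ) ^ (p - 1) := Real.rpow_le_rpow hu0.le hu3 (by linarith)
    -- `(1/3)^{p−1} = exp(−(p−1) log 3) ≤ exp(−log⁺(4eDCn/t)) ≤ t/(4eDCn)`
    have h13 : (1 / 3 : ℝ) ^ (p - 1) ≤ t / (4 * Real.exp 1 * D * C * n) := by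
      have e1 : (1 / 3 : ℝ) ^ (p - 1) = Real.exp (-((p - 1) * Real.log 3)) := by
        rw [Real.rpow_def_of_pos (by norm_num), one_div, Real.log_inv]; ring_nf
      rw [e1]
      have hK0 : 0 < 4 * Real.exp 1 * D * C * n / t := by positivity
      have h2 : max 0 (Real.log (4 * Real.exp 1 * D * C * n / t)) ≤ (p - 1) * Real.log 3 := by
        have := (div_le_iff₀ hlog3).1 (show max 0 (Real.log (4 * Real.exp 1 * D * C * n / t)) / Real.log 3 ≤ p - 1 by
          linarith)
        linarith
      have h3 : Real.log (4 * Real.exp 1 * D * C * n / t) ≤ (p - 1) * Real.log 3 := (le_max_right _ _).trans h2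
      calc Real.exp (-((p - 1) * Real.log 3)) ≤ Real.exp (-Real.log (4 * Real.exp 1 * D * C * n / t)) :=
            Real.exp_le_exp.2 (by linarith)
        _ = t / (4 * Real.exp 1 * D * C * n) := by rw [Real.exp_neg, Real.exp_log hK0, inv_div]
    have hkey : u ^ p ≤ u * (t / (4 * Real.exp 1 * D * C * n)) := by
      rw [hsplit]; exact mul_le_mul_of_nonneg_left (hupow.trans h13) hu0.le
    calc 2 * Real.exp 1 * D * u ^ p ≤ 2 * Real.exp 1 * D * (u * (t / (4 * Real.exp 1 * D * C * n))) :=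
          mul_le_mul_of_nonneg_left hkey (by positivity)
      _ = t * μ₁ := by rw [hu]; field_simp; norm_num
  · -- (B2) `c_Z = a log Q/2`: `2eD Q^{−a/(12θ)} ≤ t c₁ Q^{−2} ≤ t μ₁`
    rw [hmin]
    have hexp : Real.exp (-(a * Real.log Q / 2 / (6 * θ))) = Q ^ (-(a / (12 * θ))) := by
      rw [Real.rpow_def_of_pos hQ0]; congr 1; field_simp; ring
    rw [hexp]
    set q : ℝ := a / (12 * θ) with hq
    have hqge : 2 + max 0 (Real.log (2 * Real.exp 1 * D / (t * c₁))) / Real.log 12 ≤ q := by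
      rw [hq, le_div_iff₀ (by positivity)]; linarith
    -- `Q^{−q} = Q^{−2} Q^{−(q−2)}`, `Q^{−(q−2)} ≤ 12^{−(q−2)} ≤ t c₁/(2eD)`
    have hsplit : Q ^ (-q) = Q ^ (-(2 : ℝ)) * Q ^ (-(q - 2)) := by
      rw [← Real.rpow_add hQ0]; congr 1; ring
    have hK0 : 0 < 2 * Real.exp 1 * D / (t * c₁) := by positivity
    have hq2 : 0 ≤ q - 2 := by
      have : 0 ≤ max 0 (Real.log (2 * Real.exp 1 * D / (t * c₁))) / Real.log 12 := by positivity
      linarith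
    have hQpow : Q ^ (-(q - 2)) ≤ t * c₁ / (2 * Real.exp 1 * D) := by
      have h1 : Q ^ (-(q - 2)) ≤ (12 : ℝ) ^ (-(q - 2)) :=
        Real.rpow_le_rpow_of_nonpos (by norm_num) hQ (by linarith)
      have e1 : (12 : ℝ) ^ (-(q - 2)) = Real.exp (-((q - 2) * Real.log 12)) := by
        rw [Real.rpow_def_of_pos (by norm_num)]; ring_nf
      have h2 : max 0 (Real.log (2 * Real.exp 1 * D / (t * c₁))) ≤ (q - 2) * Real.log 12 := by
        have := (div_le_iff₀ hlog12).1 (show max 0 (Real.log (2 * Real.exp 1 * D / (t * c₁))) / Real.log 12 ≤ q - 2 by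
          linarith)
        linarith
      have h3 : Real.log (2 * Real.exp 1 * D / (t * c₁)) ≤ (q - 2) * Real.log 12 := (le_max_right _ _).trans h2
      calc Q ^ (-(q - 2)) ≤ (12 : ℝ) ^ (-(q - 2)) := h1
        _ = Real.exp (-((q - 2) * Real.log 12)) := e1
        _ ≤ Real.exp (-Real.log (2 * Real.exp 1 * D / (t * c₁))) := Real.exp_le_exp.2 (by linarith)
        _ = t * c₁ / (2 * Real.exp 1 * D) := by rw [Real.exp_neg, Real.exp_log hK0, inv_div]
    have hQ2 : 0 < Q ^ (-(2 : ℝ)) := Real.rpow_pos_of_pos hQ0 _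
    calc 2 * Real.exp 1 * D * Q ^ (-q) = 2 * Real.exp 1 * D * (Q ^ (-(2 : ℝ)) * Q ^ (-(q - 2))) := by rw [hsplit]
      _ ≤ 2 * Real.exp 1 * D * (Q ^ (-(2 : ℝ)) * (t * c₁ / (2 * Real.exp 1 * D))) :=
          mul_le_mul_of_nonneg_left (mul_le_mul_of_nonneg_left hQpow hQ2.le) (by positivity)
      _ = t * (c₁ * Q ^ (-(2 : ℝ))) := by field_simp
      _ ≤ t * μ₁ := mul_le_mul_of_nonneg_left hμQ ht.le

/-- **Absorption of the secondary terms with a `Q`-dependent collar.**  With `ε₀ ≥ e₀ Q^{−2}` (`0 < e₀`),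
`M ≥ 0`, nonnegative constants, `Q ≥ 12`, `x^{−θ/8}`-absorption hypotheses
`(2n C'/(κc₁)) Q⁷ (L+1) x^{−θ/8} ≤ 1` (`C' = 338W₀ + 96(M/(4e₀))W₀(4c₁'+c₂) + 108 + 640 ℓ A (M/(4e₀))`) and
`Q⁴ x^{−θ/8} ≤ 1`, where `e^{−θL/4} = x^{−θ/8}·x^{−θ/8}` (`L = log x`):
`n · (338W₀ + 96(M/(4ε₀))W₀(4c₁'+c₂) + 108 + 640 ℓ A (M/(4ε₀))) Q⁷ (L+1) e^{−θL/4} ≤ (κc₁/2) Q^{−2}`. -/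
theorem dh_junk_le {n W₀ M c₁' c₂ lLC A e₀ ε₀ Q x θ κ c₁ : ℝ} (hn : 0 < n) (hW₀ : 0 ≤ W₀) (hM : 0 ≤ M)
    (hc₁' : 0 ≤ c₁') (hc₂ : 0 ≤ c₂) (hlLC : 0 ≤ lLC) (hA : 0 ≤ A) (he₀ : 0 < e₀) (hε₀ : e₀ * Q ^ (-(2 : ℝ)) ≤ ε₀)
    (hQ : 12 ≤ Q) (hx : 0 < x) (hκ : 0 < κ) (hc₁ : 0 < c₁)
    (habs : (2 * n * (338 * W₀ + 96 * (M / (4 * e₀)) * W₀ * (4 * c₁' + c₂) + 108 + 640 * lLC * A * (M / (4 * e₀))) /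
        (κ * c₁)) * Q ^ (7 : ℕ) * (Real.log x + 1) * x ^ (-(θ / 8)) ≤ 1)
    (hQ4 : Q ^ (4 : ℕ) * x ^ (-(θ / 8)) ≤ 1) (hL : 0 ≤ Real.log x) :
    n * ((338 * W₀ + 96 * (M / (4 * ε₀)) * W₀ * (4 * c₁' + c₂) + 108 + 640 * lLC * A * (M / (4 * ε₀))) *
        Q ^ (7 : ℕ) * (Real.log x + 1) * Real.exp (-(θ / 4) * Real.log x)) ≤
      κ * c₁ / 2 * Q ^ (-(2 : ℝ)) := by
  have hQ0 : 0 < Q := by linarith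
  have hQ1 : (1 : ℝ) ≤ Q := by linarith
  have hQ2pos : 0 < Q ^ (-(2 : ℝ)) := Real.rpow_pos_of_pos hQ0 _
  have hε₀0 : 0 < ε₀ := lt_of_lt_of_le (by positivity) hε₀
  -- `M/(4ε₀) ≤ (M/(4e₀)) Q²`
  have hQ2 : Q ^ (2 : ℕ) * Q ^ (-(2 : ℝ)) = 1 := by
    rw [show (Q ^ (2 : ℕ) : ℝ) = Q ^ (2 : ℝ) by exact_mod_cast (Real.rpow_natCast Q 2).symm, ← Real.rpow_add hQ0]
    norm_num
  have hinv : 1 / ε₀ ≤ Q ^ (2 : ℕ) / e₀ := by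
    rw [div_le_div_iff₀ hε₀0 he₀, one_mul]
    calc e₀ = e₀ * (Q ^ (2 : ℕ) * Q ^ (-(2 : ℝ))) := by rw [hQ2, mul_one]
      _ = (e₀ * Q ^ (-(2 : ℝ))) * Q ^ (2 : ℕ) := by ring
      _ ≤ ε₀ * Q ^ (2 : ℕ) := mul_le_mul_of_nonneg_right hε₀ (by positivity)
      _ = Q ^ (2 : ℕ) * ε₀ := by ring
  have hMε : M / (4 * ε₀) ≤ M / (4 * e₀) * Q ^ (2 : ℕ) := by
    have : M / (4 * ε₀) = M / 4 * (1 / ε₀) := by field_simp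
    rw [this]
    calc M / 4 * (1 / ε₀) ≤ M / 4 * (Q ^ (2 : ℕ) / e₀) := mul_le_mul_of_nonneg_left hinv (by positivity)
      _ = M / (4 * e₀) * Q ^ (2 : ℕ) := by field_simp
  have hQsq1 : (1 : ℝ) ≤ Q ^ (2 : ℕ) := one_le_pow₀ hQ1
  set C' : ℝ := 338 * W₀ + 96 * (M / (4 * e₀)) * W₀ * (4 * c₁' + c₂) + 108 + 640 * lLC * A * (M / (4 * e₀)) with hC'
  have hC'0 : 0 ≤ C' := by rw [hC']; positivity
  have hcoef : 338 * W₀ + 96 * (M / (4 * ε₀)) * W₀ * (4 * c₁' + c₂) + 108 + 640 * lLC * A * (M / (4 * ε₀)) ≤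
      C' * Q ^ (2 : ℕ) := by
    rw [hC']
    have h1 : 338 * W₀ ≤ 338 * W₀ * Q ^ (2 : ℕ) := le_mul_of_one_le_right (by positivity) hQsq1
    have h2 : (108 : ℝ) ≤ 108 * Q ^ (2 : ℕ) := le_mul_of_one_le_right (by norm_num) hQsq1
    have h3 : 96 * (M / (4 * ε₀)) * W₀ * (4 * c₁' + c₂) ≤ 96 * (M / (4 * e₀) * Q ^ (2 : ℕ)) * W₀ * (4 * c₁' + c₂) :=
      mul_le_mul_of_nonneg_right (mul_le_mul_of_nonneg_right (mul_le_mul_of_nonneg_left hMε (by norm_num)) hW₀)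
        (by positivity)
    have h4 : 640 * lLC * A * (M / (4 * ε₀)) ≤ 640 * lLC * A * (M / (4 * e₀) * Q ^ (2 : ℕ)) :=
      mul_le_mul_of_nonneg_left hMε (by positivity)
    nlinarith
  -- `e^{−θL/4} = x^{−θ/8} x^{−θ/8}`
  have hexp : Real.exp (-(θ / 4) * Real.log x) = x ^ (-(θ / 8)) * x ^ (-(θ / 8)) := by
    rw [← Real.rpow_add hx, Real.rpow_def_of_pos hx]; congr 1; ring
  have hx8 : 0 < x ^ (-(θ / 8)) := Real.rpow_pos_of_pos hx _
  rw [hexp]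
  have hL1 : 0 < Real.log x + 1 := by linarith
  -- the product of the two absorption factors
  have hprod : (2 * n * C' / (κ * c₁) * Q ^ (7 : ℕ) * (Real.log x + 1) * x ^ (-(θ / 8))) *
      (Q ^ (4 : ℕ) * x ^ (-(θ / 8))) ≤ 1 := by
    calc _ ≤ 1 * (Q ^ (4 : ℕ) * x ^ (-(θ / 8))) := mul_le_mul_of_nonneg_right habs (by positivity)
      _ ≤ 1 * 1 := mul_le_mul_of_nonneg_left hQ4 zero_le_one
      _ = 1 := one_mul _
  have hQm2 : Q ^ (-(2 : ℝ)) = (Q ^ (2 : ℕ))⁻¹ := by rw [Real.rpow_neg hQ0.le, Real.rpow_two]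
  have e : n * (C' * Q ^ (2 : ℕ) * Q ^ (7 : ℕ) * (Real.log x + 1) * (x ^ (-(θ / 8)) * x ^ (-(θ / 8)))) =
      (κ * c₁ / 2 * Q ^ (-(2 : ℝ))) *
        ((2 * n * C' / (κ * c₁) * Q ^ (7 : ℕ) * (Real.log x + 1) * x ^ (-(θ / 8))) * (Q ^ (4 : ℕ) * x ^ (-(θ / 8)))) := by
    rw [hQm2]
    field_simp
  calc n * ((338 * W₀ + 96 * (M / (4 * ε₀)) * W₀ * (4 * c₁' + c₂) + 108 + 640 * lLC * A * (M / (4 * ε₀))) *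
        Q ^ (7 : ℕ) * (Real.log x + 1) * (x ^ (-(θ / 8)) * x ^ (-(θ / 8))))
      ≤ n * (C' * Q ^ (2 : ℕ) * Q ^ (7 : ℕ) * (Real.log x + 1) * (x ^ (-(θ / 8)) * x ^ (-(θ / 8)))) := by
        refine mul_le_mul_of_nonneg_left ?_ hn.le
        exact mul_le_mul_of_nonneg_right (mul_le_mul_of_nonneg_right (mul_le_mul_of_nonneg_right hcoef
          (by positivity)) hL1.le) (by positivity)
    _ = (κ * c₁ / 2 * Q ^ (-(2 : ℝ))) *
        ((2 * n * C' / (κ * c₁) * Q ^ (7 : ℕ) * (Real.log x + 1) * x ^ (-(θ / 8))) * (Q ^ (4 : ℕ) * x ^ (-(θ / 8)))) := e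
    _ ≤ (κ * c₁ / 2 * Q ^ (-(2 : ℝ))) * 1 := mul_le_mul_of_nonneg_left hprod (by positivity)
    _ = κ * c₁ / 2 * Q ^ (-(2 : ℝ)) := mul_one _

end Summit.QuantumAdvantage.QuantumAdvantage.Theorems.DegreeOnePrimesEscape

end
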